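import Literature.NumberTheory.Automorphic.ArthurClozelGalOrbitDescentOffS
import Summits.Langlands.Langlands.Theses.QuadraticWindow
import Summits.Langlands.Langlands.Theorems.QuadraticWindowAutomorphicInductionUnramifiedOffSPlace
import HarnessLib

/-!
# Crux `QuadraticWindow.AutomorphicInductionUnramified` (stmt-Langlands-15138), line `Sketch`
# (`s-threaded-comparison`): the crux from the `S`-threaded Thm. 4.2 (e) and multiplicity one

The crux `Summit.Langlands.Langlands.Theses.QuadraticWindow.AutomorphicInductionUnramified` is verbatim
the named fact `Literature.NumberTheory.Automorphic.automorphicInduction_cyclic_cuspidal_unramified`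
(cyclic automorphic induction of prime degree, cuspidal case, with the Hecke–Satake relation
(6.1)–(6.2) at EVERY finite place unramified for the data; Arthur–Clozel, Ann. of Math. Stud. 120,
Ch. 3, Thm. 4.2 (e), Thm. 6.2, Lemma 6.4; Henniart 2012, Thms. 3 and 5).

This file proves it CONDITIONALLY on two named facts of the literature, and on nothing else:

* `Literature.NumberTheory.Automorphic.ArthurClozel1989_descent_of_galOrbit_offS F E m` for all
  `F`, `E`, `m` (`ArthurClozelGalOrbitDescentOffS`): Arthur–Clozel's Thm. 4.2 (e) read with the
  spherical set `S` of the comparison of trace formulae (4.1) = (4.2) threaded through (pp. 203–209: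
  the cuspidal `π` lifted by `Π₁ × ⋯ × Π₁^{σ^{l-1}}` is produced against functions `f = f_S ⊗ bφ^S`
  spherical outside any finite `S ⊇ Ram(E/F) ∪ Ram(Π)`, hence is unramified outside `S` with the
  relation (1.1) at every `v ∉ S`) — the ONE theory-sized leaf of the line (twisted trace formula);
* `Literature.NumberTheory.Automorphic.multiplicity_one_gl` (Shalika 1974, Piatetski-Shapiro 1979),
  under which "`Π₁ ≇ Π₁^σ`" is the inequality of subspaces of `L²_cusp` that the leaf takes as input.

Everything downstream is proved, along Arthur–Clozel's proof of Thm. 6.2 (PDF p. 185) exactly as in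
the tree's `automorphicInduction_cyclic_cuspidal_unramified_of_strongLifting_galOrbit_of_iff_L2'`
(`AutomorphicInductionCuspidalUnramifiedStrongLifting`), whose hypothesis `h51` (Thm. 5.1 for the orbit
at the unramified places) is replaced by ONE call of the leaf at the admissible set
`S₀ = Ram(E/K) ∪ {v : some conjugate of Q₁ is ramified above v}` (`exists_admissible_finite`) and the
place-by-place reading `stub_offS_place` (landed, `QuadraticWindowAutomorphicInductionUnramifiedOffSPlace`):
normalise `π` to `Q₁ ≤ L²_cusp` over `E` keeping the Satake parameters at every place
(`exists_satake_eq_cpow_mul_L2_pointwise`); `Q₁` is not `Gal`-stable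
(`isGaloisStableSatakeAE_of_forall_isGalStable`); the leaf gives the cuspidal `P` over `K` with
`P ⊗ η = P` and a Satake family `αF` off `S₀` related to the families of the conjugates; realise `P` by
a Borel–Jacquet datum (`exists_cuspidalRepData_of_L2_holds`) twisted by `|det|^{-s}`; at `v ∉ S₀`:
`η(ϖ_v)`-stability of `αF v` (`map_valueAtUniformizer_mul_eq_of_twistByFiniteOrderChar_eq`), the order
`f_v` of `η(ϖ_v)` (`isPrimitiveRoot_valueAtUniformizer`), and (6.5)–(6.6) ⟹ (6.1)–(6.2)
(`satakePolynomial_eq_inducedSatakePolynomial_of_sum_smul_eq`).  The Borel–Jacquet dictionary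
`hasSatakeParamAt_iff_L2_holds` is a theorem of the tree.

So the residue of the crux is `{ArthurClozel1989_descent_of_galOrbit_offS, multiplicity_one_gl}`; the
leaf refines the almost-everywhere leaf `ArthurClozel1989_descent_of_galOrbit` of
`automorphicInduction_cyclic_cuspidal` (`ArthurClozel1989_descent_of_galOrbit_of_offS`), so this is ONE
black box where `…_of_leaves` (a.e. fact + Henniart Thm. 5) and `…_of_strongLifting_galOrbit`
(Thm. 4.2 (e) + Thm. 5.1) have two, and no local representation theory of `GL_n(K_v)` is on the road.

References: [ArthurClozelAMS120] Ch. 3, §1 (1.1), Thm. 4.2 (e) and its proof pp. 203–209, Def. 6.1,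
Thm. 6.2 (proof, PDF p. 185), Lemma 6.4; [BorelJacquet1979] 4.6, 5.7; [Henniart2012] Thm. 3, Thm. 5.
-/

noncomputable section

open scoped Classical
open NumberField IsDedekindDomain MeasureTheory Filter
open Literature.NumberTheory.Automorphic Literature.NumberTheory.Automorphic.AdelicGroupData
open Literature.NumberTheory.GaloisRepresentations (HeckeCharacter)

-- `Summit.Langlands.Langlands.…` (summit = sub-problem name, D-0017 layout) trips `dupNamespace`.
set_option linter.dupNamespace false

namespace Summit.Langlands.Langlands.Theorems.AutomorphicInductionUnramified.Sketch

/-- **The crux from the two leaves** (the registered stub `stub_assembly` of the line's skeleton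
`Cruxes/AutomorphicInductionUnramified/Lines/Sketch.lean`): cyclic automorphic induction of prime
degree, cuspidal case, with the Hecke–Satake relation at every finite place unramified for the data,
GRANTED Arthur–Clozel's Thm. 4.2 (e) with the spherical set threaded
(`ArthurClozel1989_descent_of_galOrbit_offS`, every base field, extension and rank) and multiplicity
one on `L²_cusp(GL_n)` (`multiplicity_one_gl`).  Proof: Arthur–Clozel's proof of Thm. 6.2, case
`π_E ≇ π_E^σ` (PDF p. 185), with Lemma 6.4, run with the `S`-threaded Thm. 4.2 (e) at the admissible
set `S₀` of `exists_admissible_finite`; the template is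
`automorphicInduction_cyclic_cuspidal_unramified_of_strongLifting_galOrbit_of_iff_L2'` with its call of
`h51` replaced by `stub_offS_place`.  CONDITIONAL result (the two hypotheses are undischarged named
facts). -/
theorem AutomorphicInductionUnramified_of_descentOffS
    (hS : ∀ (F E : Type) [Field F] [NumberField F] [Field E] [NumberField E] [Algebra F E] (m : ℕ),
      ArthurClozel1989_descent_of_galOrbit_offS F E m)
    (hm1 : ∀ (n : ℕ) (K : Type) [Field K] [NumberField K] (μ : Measure (gl n K).automorphicQuotient)
      [(gl n K).IsAutomorphicMeasure μ], multiplicity_one_gl n K μ) :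
    Summit.Langlands.Langlands.Theses.QuadraticWindow.AutomorphicInductionUnramified := by
  intro n K E _ _ _ _ _ _ hcyc hl hn hE hK π hπ
  classical
  -- reduce to the size `[E:K] n` produced by Thm. 4.2 (e)
  suffices key : ∀ N : ℕ, N = Module.finrank K E * n →
      ∀ hK' : isCompact_glFiniteIntegralLevel N K, ∃ ρ : CuspidalAutomorphicRepData N K hK',
        ∀ (v : HeightOneSpectrum (𝓞 K)) (βπ : HeightOneSpectrum (𝓞 E) → Multiset ℂ),
          Algebra.IsUnramifiedIn (𝓞 E) v.asIdeal →
          (∀ w : HeightOneSpectrum (𝓞 E), w.asIdeal.under (𝓞 K) = v.asIdeal →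
              π.1.HasSatakeParamAt w (βπ w)) →
            ∃ α : Multiset ℂ, ρ.1.HasSatakeParamAt v α ∧
              satakePolynomial α = inducedSatakePolynomial v βπ from
    key _ (Nat.mul_comm _ _) hK
  rintro N rfl hK'
  haveI : NeZero n := ⟨hn.ne'⟩
  haveI : FiniteDimensional K E := Module.finite_of_finrank_pos hl.pos
  haveI := hcyc
  /- Step A (`E` side): the unitary normalisation `Q₁` of `π`, keeping the Satake parameters at
  every place; it is not `Gal(E/K)`-stable. -/
  obtain ⟨ν, hνA⟩ := AdelicGroupData.exists_isAutomorphicMeasure_gl_holds n E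
  haveI := hνA
  have hνG : IsGalInvariant K ν :=
    isGalInvariant_of_unique K (isAutomorphicMeasure_unique_smul_holds n E) ν
  obtain ⟨π₀, h0W', h0π⟩ :=
    CuspidalAutomorphicRepData.exists_clean_hasSatakeParamAt_iff_of_sSup_irreducible
      (AutomorphicRepsGL.stable_cuspidal_eq_sSup_irreducible_holds (hcpt := hE)) π
  obtain ⟨s, Q₁, Sπ, Aπ, hSπ, hAQ, hiff, hdict⟩ :=
    CuspidalAutomorphicRepData.exists_satake_eq_cpow_mul_L2_pointwise
      (AutomorphicRepsGL.exists_isAssociatedL2_holds hE ν) (hasSatakeParamAt_iff_L2_holds hE ν) π π₀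
      h0W' h0π
  have hnst : ∃ σ : E ≃ₐ[K] E, ¬ Q₁.IsGalStable K hνG σ := by
    by_contra h
    push Not at h
    exact hπ (π.isGaloisStableSatakeAE_of_forall_isGalStable K hνG hSπ hAQ hiff h)
  /- Step B: the class-field character `η`, the admissible exceptional set `S₀` (places ramified in
  `E` or below a ramified place of a conjugate of `Q₁`) and the `S`-threaded Thm. 4.2 (e) at `S₀`:
  `P` over `K`, `P ⊗ η = P`, with a Satake family `αF` off `S₀` related to those of the conjugates. -/
  obtain ⟨η, hηcf, -⟩ : ∃ η : HeckeCharacter K,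
      η.IsClassFieldCharacter E ∧ orderOf η = Module.finrank K E :=
    exists_isClassFieldCharacter_holds (F := K) (E := E)
  obtain ⟨S₀, hS₀, hunr₀, hram₀, hout₀⟩ := exists_admissible_finite (F := K) hνG Q₁
  obtain ⟨μ, hμA, P, αF, A, -, htwist, -, hαP, hA, hrel⟩ :=
    hS K E n hn hl η hηcf ν (hm1 n E ν) hνG Q₁ hnst S₀ hS₀ hunr₀ hram₀
  haveI := hμA
  /- Step C (`K` side): the Borel–Jacquet datum realising `P`, twisted by `|det|^{-s}`. -/
  obtain ⟨π', -, hass⟩ := AutomorphicRepsGL.exists_cuspidalRepData_of_L2_holds hK' μ P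
  obtain ⟨χ, hχ⟩ := exists_heckeCharacter_ideleNorm_cpow K (-s)
  haveI : NeZero (Module.finrank K E * n) := ⟨(Nat.mul_pos hl.pos hn).ne'⟩
  obtain ⟨ρ, hρW, hρW'⟩ := exists_cuspidalAutomorphicRepData_map_mulChar_detTwist hχ π'
  refine ⟨ρ, fun v βπ hvE hβπ => ?_⟩
  /- Step D: at a place `v` unramified in `E` above which `π` has Satake parameters `βπ w`. -/
  have he : v.asIdeal.ramificationIdxIn (𝓞 E) = 1 :=
    Literature.NumberTheory.GaloisRepresentations.ramificationIdxIn_eq_one_of_isUnramifiedIn hvE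
  obtain ⟨w₀, hw₀⟩ : ∃ w₀ : HeightOneSpectrum (𝓞 E), w₀.under (𝓞 K) = v :=
    HeightOneSpectrum.under_surjective v
  have hw₀' : w₀.asIdeal.under (𝓞 K) = v.asIdeal := congrArg HeightOneSpectrum.asIdeal hw₀
  have hσw : ∀ σ : E ≃ₐ[K] E, (σ⁻¹ • w₀).asIdeal.under (𝓞 K) = v.asIdeal := fun σ => by
    rw [← hw₀']
    exact congrArg HeightOneSpectrum.asIdeal (HeightOneSpectrum.under_algEquiv_smul K E σ⁻¹ w₀)
  -- the `L²` Satake parameters `q^{-s} βπ(σ⁻¹ w₀)` of `Q₁` at the places `σ⁻¹ w₀` over `v`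
  set β : (E ≃ₐ[K] E) → Multiset ℂ := fun σ =>
    (βπ (σ⁻¹ • w₀)).map ((((σ⁻¹ • w₀).residueCard : ℂ) ^ (-s)) * ·) with hβdef
  have hβσ : ∀ σ : E ≃ₐ[K] E, ∃ (𝔑 : Ideal (𝓞 E)) (ϖ' : ((σ⁻¹ • w₀).adicCompletion E)ˣ),
      𝔑 ≠ 0 ∧ ¬ (σ⁻¹ • w₀).asIdeal ∣ 𝔑 ∧
        HasSatakeParameterAt Q₁.1 (principalCongruenceLevel n E 𝔑) (σ⁻¹ • w₀) ϖ' (β σ) := fun σ =>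
    (hdict (σ⁻¹ • w₀) (βπ (σ⁻¹ • w₀))).1 (hβπ _ (hσw σ))
  -- the `S`-threaded relation read at `v ∉ S₀`: `P` is unramified at `v` with (6.5)–(6.6)
  obtain ⟨𝔫, ϖ, h𝔫, hv𝔫, hα, hsum⟩ :=
    stub_offS_place hνG P Q₁ hout₀ hαP hA hrel v w₀ hw₀' hvE β hβσ
  /- Step E: `η(ϖ_v)`-stability of `αF v` (`P ⊗ η = P`, Lemma 6.4) and the order of `η(ϖ_v)`. -/
  have hunr : η.IsUnramifiedAt v := hηcf.isUnramifiedAt_of_ramificationIdxIn_eq_one hl he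
  have hfix : (αF v).map (η.valueAtUniformizer v * ·) = αF v :=
    P.map_valueAtUniformizer_mul_eq_of_twistByFiniteOrderChar_eq hηcf.isFiniteOrder htwist hunr h𝔫
      hv𝔫 hα
  have hζ : IsPrimitiveRoot (η.valueAtUniformizer v) (w₀.asIdeal.inertiaDeg (𝓞 K)) := by
    rw [inertiaDeg_eq_inertiaDegIn_of_under_eq v hw₀']
    exact hηcf.isPrimitiveRoot_valueAtUniformizer hl he
  /- Step F: the datum `ρ` has Satake parameter `q_v^{s} αF v` at `v`. -/
  have hπ'v : π'.1.HasSatakeParamAt v (αF v) :=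
    (hasSatakeParamAt_iff_L2_holds hK' μ hass v (αF v)).2 ⟨𝔫, ϖ, h𝔫, hv𝔫, hα⟩
  have hρv : ρ.1.HasSatakeParamAt v ((αF v).map (((v.residueCard : ℂ) ^ s) * ·)) := by
    have h := AutomorphicRepData.HasSatakeParamAt.of_map_mulChar_detTwist_of_cpow hχ hρW hρW' hπ'v
    rwa [neg_neg] at h
  refine ⟨_, hρv, ?_⟩
  /- Step G: (6.5)–(6.6) for the twisted parameters and the conclusion (6.1)–(6.2). -/
  -- `q_{w₀}^{s} = (q_v^{s})^{f}`
  have hq : (w₀.residueCard : ℂ) ^ s =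
      ((v.residueCard : ℂ) ^ s) ^ w₀.asIdeal.inertiaDeg (𝓞 K) := by
    rw [residueCard_eq_pow_inertiaDeg (F := K) w₀, hw₀, natCast_pow_cpow]
  have hRβ : ∑ σ : E ≃ₐ[K] E, βπ (σ⁻¹ • w₀) =
      ((αF v).map (((v.residueCard : ℂ) ^ s) * ·)).map (· ^ w₀.asIdeal.inertiaDeg (𝓞 K)) := by
    -- `βπ(σ⁻¹ w₀) = q_{w₀}^{s} β σ`
    have h1 : ∀ σ : E ≃ₐ[K] E, βπ (σ⁻¹ • w₀) = (β σ).map (((w₀.residueCard : ℂ) ^ s) * ·) := by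
      intro σ
      rw [hβdef]
      dsimp only
      rw [residueCard_smul K σ⁻¹ w₀, Multiset.map_map]
      have hid : ((fun x : ℂ => (w₀.residueCard : ℂ) ^ s * x) ∘
          fun x => (w₀.residueCard : ℂ) ^ (-s) * x) = id :=
        funext fun a => residueCard_cpow_mul_cpow_neg_mul w₀ s a
      rw [hid, Multiset.map_id]
    calc ∑ σ : E ≃ₐ[K] E, βπ (σ⁻¹ • w₀)
        = ∑ σ : E ≃ₐ[K] E, (β σ).map (((w₀.residueCard : ℂ) ^ s) * ·) :=
          Finset.sum_congr rfl fun σ _ => h1 σ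
      _ = (∑ σ : E ≃ₐ[K] E, β σ).map (((w₀.residueCard : ℂ) ^ s) * ·) :=
          (multiset_map_finset_sum _ _ _).symm
      _ = ((αF v).map (((v.residueCard : ℂ) ^ s) * ·)).map (· ^ w₀.asIdeal.inertiaDeg (𝓞 K)) := by
          rw [hsum, Multiset.map_map, Multiset.map_map]
          refine Multiset.map_congr rfl fun b _ => ?_
          simp only [Function.comp_apply]
          rw [mul_pow, ← hq]
  -- `ζ`-stability of `q_v^{s} αF v`
  have hZ : ((αF v).map (((v.residueCard : ℂ) ^ s) * ·)).map (η.valueAtUniformizer v * ·) =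
      (αF v).map (((v.residueCard : ℂ) ^ s) * ·) := by
    conv_rhs => rw [← hfix]
    rw [Multiset.map_map, Multiset.map_map]
    refine Multiset.map_congr rfl fun b _ => ?_
    simp only [Function.comp_apply]
    ring
  exact satakePolynomial_eq_inducedSatakePolynomial_of_sum_smul_eq hl hvE hw₀' βπ hRβ hζ hZ

/-- The same statement read as the Literature named fact
`automorphicInduction_cyclic_cuspidal_unramified` (definitionally the crux): its residue is
`{ArthurClozel1989_descent_of_galOrbit_offS, multiplicity_one_gl}`. -/
theorem automorphicInduction_cyclic_cuspidal_unramified_of_descentOffS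
    (hS : ∀ (F E : Type) [Field F] [NumberField F] [Field E] [NumberField E] [Algebra F E] (m : ℕ),
      ArthurClozel1989_descent_of_galOrbit_offS F E m)
    (hm1 : ∀ (n : ℕ) (K : Type) [Field K] [NumberField K] (μ : Measure (gl n K).automorphicQuotient)
      [(gl n K).IsAutomorphicMeasure μ], multiplicity_one_gl n K μ) :
    automorphicInduction_cyclic_cuspidal_unramified :=
  AutomorphicInductionUnramified_of_descentOffS hS hm1

end Summit.Langlands.Langlands.Theorems.AutomorphicInductionUnramified.Sketch

end
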